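import Summits.QuantumAdvantage.QuantumAdvantage.Theorems.DigitRung.Negative.Reduction
import Literature.NumberTheory.QuadraticFields.SquarefreeModFour

/-!
# `EndJuntaRung` (stmt-QuantumAdvantage-2426) — from progressions `mod 2ᵏ` to end-bit cylinders

Route `ArithStatLadder`, support item `EndJuntaRung` (R0: the centred 3-torsion `t(−d) − 2` has
vanishing correlation with every junta on `k` low + `k` high binary digits of `d`, along `n`-bit
fundamental `−d`). This file is the BOOKKEEPING half ("low bits = class of `−d mod 2ᵏ`, high bits
= a dyadic sub-interval of `[2ⁿ⁻¹, 2ⁿ)`"):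

* `endJuntaRung_of_progressions` — if for every `k`, every class `a (mod 2ᵏ)` and every `ε > 0`,
  eventually `|Σ_{−X<D<0 fund., D ≡ a (2ᵏ)} (#Cl₃(D) − 2)| ≤ ε X`, then `EndJuntaRung` holds.

Ingredients: the pinning hypothesis fixes `t = quadFieldThreeTorsion` on the block
(`DigitRung/Negative/Reduction.lean`); a non-empty cylinder is the set of `d` in the block with
prescribed `d mod 2ᵏ` and `⌊d/2ⁿ⁻ᵏ⌋`, i.e. a progression `mod 2ᵏ` meeting an interval
`[lo, hi) ⊆ [2ⁿ⁻¹, 2ⁿ]`, so its centred sum is a difference of two initial sums; and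
`#𝒟_n ≥ 2ⁿ/16` eventually (density `3/π²` of imaginary quadratic fields,
`tendsto_card_negFundDiscrs_div`, PROVED in the tree).
-/

noncomputable section

set_option linter.dupNamespace false -- D-0017: single-problem summit ⇒ `QuantumAdvantage.QuantumAdvantage` by design

namespace Summit.QuantumAdvantage.QuantumAdvantage.Theorems.ArithStatLadder

open scoped Classical
open Filter Finset
open Literature.NumberTheory.QuadraticFields
open Summit.QuantumAdvantage.DigitRung.Negative
open Summit.QuantumAdvantage.QuantumAdvantage.Theses.ArithStatLadder (EndJuntaRung)

/-! ## Negative fundamental discriminants `D = −d`, `0 < d < X` -/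

/-- `0` is not (minus) a fundamental discriminant. -/
theorem not_isNegFund_zero : ¬ IsNegFund 0 := by
  intro h
  rcases h with ⟨h1, -, -⟩ | ⟨-, h2, -⟩
  · norm_num at h1
  · norm_num at h2

/-- Re-indexing `D = −d`: a sum over `D ∈ negFundDiscrs X` with a condition `P` is the sum over
`d < X` with `−d` fundamental and `P (−d)`. -/
theorem sum_negFundDiscrs_filter_eq_sum_range (X : ℕ) (P : ℤ → Prop) [DecidablePred P]
    (g : ℤ → ℝ) :
    ∑ D ∈ (negFundDiscrs X).filter P, g D =
      ∑ d ∈ (Finset.range X).filter (fun d : ℕ => IsNegFund d ∧ P (-(d:ℤ))), g (-(d:ℤ)) := by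
  refine Finset.sum_nbij' (fun D => D.natAbs) (fun d => -(d:ℤ)) ?_ ?_ ?_ ?_ ?_
  · intro D hD
    simp only [mem_filter, mem_negFundDiscrs, mem_range] at hD ⊢
    obtain ⟨⟨⟨hlo, hhi⟩, hfund⟩, hP⟩ := hD
    have hDabs : -((D.natAbs : ℕ) : ℤ) = D := by omega
    refine ⟨by omega, ?_, by rwa [hDabs]⟩
    dsimp only [IsNegFund]
    rw [hDabs]
    exact hfund
  · intro d hd
    simp only [mem_filter, mem_negFundDiscrs, mem_range] at hd ⊢
    obtain ⟨hdX, hfund, hP⟩ := hd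
    have hd0 : d ≠ 0 := by
      rintro rfl
      exact not_isNegFund_zero hfund
    exact ⟨⟨⟨by omega, by omega⟩, hfund⟩, hP⟩
  · intro D hD
    simp only [mem_filter, mem_negFundDiscrs] at hD
    have : D < 0 := hD.1.1.2
    omega
  · intro d _
    simp
  · intro D hD
    simp only [mem_filter, mem_negFundDiscrs] at hD
    have hDabs : -((D.natAbs : ℕ) : ℤ) = D := by omega
    rw [hDabs]

/-- The number of imaginary quadratic fields with `|disc| < X` is the number of `d < X` with `−d`
fundamental. -/
theorem card_negFundDiscrs_eq_card_range (X : ℕ) :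
    ((negFundDiscrs X).card : ℝ) = ((Finset.range X).filter (fun d : ℕ => IsNegFund d)).card := by
  have h := sum_negFundDiscrs_filter_eq_sum_range X (fun _ => True) (fun _ => 1)
  rw [Finset.filter_true_of_mem (fun _ _ => trivial)] at h
  simpa only [Finset.sum_const, nsmul_eq_mul, mul_one, and_true] using h

/-! ## The block `𝒟_n` has positive density -/

/-- `#𝒟_n = N(2ⁿ) − N(2ⁿ⁻¹)` with `N(X) = #negFundDiscrs X`. -/
theorem card_block_eq_sub (n : ℕ) :
    ((block n).card : ℝ) = (negFundDiscrs (2 ^ n)).card - (negFundDiscrs (2 ^ (n - 1))).card := by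
  rw [card_negFundDiscrs_eq_card_range, card_negFundDiscrs_eq_card_range]
  have hsplit : (Finset.range (2 ^ n)).filter (fun d : ℕ => IsNegFund d) =
      (Finset.range (2 ^ (n - 1))).filter (fun d : ℕ => IsNegFund d) ∪ block n := by
    have : 2 ^ (n - 1) ≤ 2 ^ n := Nat.pow_le_pow_right two_pos (Nat.sub_le n 1)
    ext d
    simp only [mem_filter, mem_range, mem_union, mem_block]
    constructor
    · rintro ⟨hd, hf⟩
      by_cases hlt : d < 2 ^ (n - 1)
      · exact Or.inl ⟨hlt, hf⟩
      · exact Or.inr ⟨⟨by omega, hd⟩, hf⟩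
    · rintro (⟨hd, hf⟩ | ⟨⟨-, hd⟩, hf⟩)
      · exact ⟨by omega, hf⟩
      · exact ⟨hd, hf⟩
  have hdisj : Disjoint ((Finset.range (2 ^ (n - 1))).filter (fun d : ℕ => IsNegFund d))
      (block n) := by
    rw [Finset.disjoint_left]
    intro d hd hd'
    rw [mem_filter, mem_range] at hd
    rw [mem_block] at hd'
    omega
  rw [hsplit, Finset.card_union_of_disjoint hdisj]
  push_cast
  ring

/-- **Density of the block.** Eventually `2ⁿ ≤ 16 · #𝒟_n` (the imaginary quadratic fields have
density `3/π² > 3/10`, so a dyadic block holds at least `(3/π²)(1/2 − o(1)) 2ⁿ` of them). -/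
theorem eventually_two_pow_le_card_block :
    ∀ᶠ n : ℕ in atTop, (2 : ℝ) ^ n ≤ 16 * ((block n).card : ℝ) := by
  set ρ : ℝ := 3 / Real.pi ^ 2 with hρ
  have hρpos : 3 / 10 < ρ := by
    have hπ : Real.pi ^ 2 < 10 := by nlinarith [Real.pi_lt_d2, Real.pi_pos]
    rw [hρ, lt_div_iff₀ (by positivity)]
    nlinarith
  have hlim := tendsto_card_negFundDiscrs_div
  have h2 : Tendsto (fun n : ℕ => 2 ^ n) atTop atTop :=
    tendsto_pow_atTop_atTop_of_one_lt one_lt_two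
  have hA : ∀ᶠ n : ℕ in atTop,
      ρ - ρ / 6 ≤ ((negFundDiscrs (2 ^ n)).card : ℝ) / ((2 ^ n : ℕ) : ℝ) :=
    (hlim.comp h2).eventually (eventually_ge_nhds (show ρ - ρ / 6 < ρ by linarith))
  have hB : ∀ᶠ n : ℕ in atTop,
      ((negFundDiscrs (2 ^ (n - 1))).card : ℝ) / ((2 ^ (n - 1) : ℕ) : ℝ) ≤ ρ + ρ / 6 :=
    (hlim.comp (h2.comp (tendsto_sub_atTop_nat 1))).eventually
      (eventually_le_nhds (show ρ < ρ + ρ / 6 by linarith))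
  filter_upwards [hA, hB, eventually_ge_atTop 1] with n hnA hnB hn1
  rw [card_block_eq_sub n]
  set P : ℝ := ((2 ^ (n - 1) : ℕ) : ℝ) with hP
  have hPpos : 0 < P := by positivity
  have hpow : ((2 ^ n : ℕ) : ℝ) = 2 * P := by
    rw [hP, ← Nat.cast_two (R := ℝ), ← Nat.cast_mul]
    congr 1
    rw [← pow_succ']
    congr 1
    omega
  have hcast : (2 : ℝ) ^ n = 2 * P := by rw [← hpow]; push_cast; ring
  rw [hpow, le_div_iff₀ (by positivity)] at hnA
  rw [div_le_iff₀ hPpos] at hnB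
  rw [hcast]
  nlinarith

/-! ## Cylinders on `k` low and `k` high bits -/

/-- **A non-empty cylinder is a residue-and-quotient class.** If `d₀ ∈ 𝒟_n` lies in the cylinder
of the pattern `a` on the `k` low and `k` high bits (`k ≤ n`), the cylinder consists of the
`d ∈ 𝒟_n` with `d ≡ d₀ (mod 2ᵏ)` and `⌊d/2ⁿ⁻ᵏ⌋ = ⌊d₀/2ⁿ⁻ᵏ⌋`. -/
theorem cylinder_eq_of_mem {n k : ℕ} (hk : k ≤ n) {a : ℕ → Bool} {d₀ : ℕ}
    (hd₀ : d₀ ∈ (block n).filter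
      (fun d : ℕ => ∀ i < n, (i < k ∨ n ≤ i + k) → Nat.testBit d i = a i)) :
    (block n).filter (fun d : ℕ => ∀ i < n, (i < k ∨ n ≤ i + k) → Nat.testBit d i = a i) =
      (block n).filter
        (fun d : ℕ => d % 2 ^ k = d₀ % 2 ^ k ∧ d / 2 ^ (n - k) = d₀ / 2 ^ (n - k)) := by
  rw [Finset.mem_filter, mem_block] at hd₀
  obtain ⟨⟨⟨-, hd₀n⟩, -⟩, ha₀⟩ := hd₀
  ext d
  simp only [Finset.mem_filter, mem_block, and_congr_right_iff]
  rintro ⟨⟨-, hdn⟩, -⟩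
  constructor
  · intro ha
    constructor
    · refine Nat.eq_of_testBit_eq fun i => ?_
      rw [Nat.testBit_mod_two_pow, Nat.testBit_mod_two_pow]
      by_cases hi : i < k
      · rw [ha i (by omega) (Or.inl hi), ha₀ i (by omega) (Or.inl hi)]
      · simp [hi]
    · refine Nat.eq_of_testBit_eq fun i => ?_
      rw [Nat.testBit_div_two_pow, Nat.testBit_div_two_pow]
      by_cases hi : i + (n - k) < n
      · rw [ha _ hi (Or.inr (by omega)), ha₀ _ hi (Or.inr (by omega))]
      · rw [Nat.testBit_lt_two_pow (hdn.trans_le (Nat.pow_le_pow_right two_pos (by omega))),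
          Nat.testBit_lt_two_pow (hd₀n.trans_le (Nat.pow_le_pow_right two_pos (by omega)))]
  · rintro ⟨hmod, hdiv⟩ i hi hik
    rw [← ha₀ i hi hik]
    rcases hik with hik | hik
    · have h1 := congrArg (fun x => Nat.testBit x i) hmod
      simpa only [Nat.testBit_mod_two_pow, hik, decide_true, Bool.true_and] using h1
    · have h1 := congrArg (fun x => Nat.testBit x (i - (n - k))) hdiv
      simp only [Nat.testBit_div_two_pow] at h1
      rwa [show i - (n - k) + (n - k) = i by omega] at h1

/-- `d / M = q ↔ q M ≤ d < q M + M` (`M > 0`). -/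
theorem div_eq_iff_le_and_lt {d M q : ℕ} (hM : 0 < M) : d / M = q ↔ q * M ≤ d ∧ d < q * M + M := by
  rw [show q * M + M = (q + 1) * M by ring, ← Nat.div_lt_iff_lt_mul hM, ← Nat.le_div_iff_mul_le hM]
  omega

/-- **A residue-and-quotient class of the block is a progression on an interval inside
`[2ⁿ⁻¹, 2ⁿ]`**: there are `2ⁿ⁻¹ ≤ lo ≤ hi ≤ 2ⁿ` with
`{d ∈ 𝒟_n : d mod 2ᵏ = ρ, ⌊d/M⌋ = q} = {lo ≤ d < hi : −d fund., d mod 2ᵏ = ρ}` (`M = 2ⁿ⁻ᵏ`). -/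
theorem exists_Ico_eq_filter_mod_div (n k ρ q : ℕ) :
    ∃ lo hi : ℕ, 2 ^ (n - 1) ≤ lo ∧ lo ≤ hi ∧ hi ≤ 2 ^ n ∧
      (block n).filter (fun d : ℕ => d % 2 ^ k = ρ ∧ d / 2 ^ (n - k) = q) =
        (Finset.Ico lo hi).filter (fun d : ℕ => IsNegFund d ∧ d % 2 ^ k = ρ) := by
  set M := 2 ^ (n - k) with hM
  have hMpos : 0 < M := by positivity
  have hPQ : 2 ^ (n - 1) ≤ 2 ^ n := Nat.pow_le_pow_right two_pos (Nat.sub_le n 1)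
  set A := q * M with hA
  set lo := min (max A (2 ^ (n - 1))) (2 ^ n) with hlo
  set hi := max lo (min (A + M) (2 ^ n)) with hhi
  refine ⟨lo, hi, ?_, le_max_left _ _, ?_, ?_⟩
  · rw [hlo]; omega
  · rw [hhi, hlo]; omega
  · ext d
    simp only [Finset.mem_filter, mem_block, mem_Ico, div_eq_iff_le_and_lt hMpos]
    rw [hhi, hlo]
    constructor
    · rintro ⟨⟨⟨h1, h2⟩, hf⟩, hρ, h3, h4⟩
      exact ⟨⟨by omega, by omega⟩, hf, hρ⟩
    · rintro ⟨⟨h1, h2⟩, hf, hρ⟩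
      exact ⟨⟨⟨by omega, by omega⟩, hf⟩, hρ, by omega, by omega⟩

/-- A filtered sum over `[lo, hi)` is a difference of two initial sums. -/
theorem sum_Ico_filter_eq_sub {lo hi : ℕ} (h : lo ≤ hi) (F : ℕ → Prop) [DecidablePred F]
    (f : ℕ → ℝ) :
    ∑ d ∈ (Finset.Ico lo hi).filter F, f d =
      ∑ d ∈ (Finset.range hi).filter F, f d - ∑ d ∈ (Finset.range lo).filter F, f d := by
  rw [Finset.sum_filter, Finset.sum_filter, Finset.sum_filter, Finset.range_eq_Ico,
    Finset.sum_Ico_eq_sub _ h, Finset.range_eq_Ico]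

/-! ## From progressions to cylinders -/

/-- The class `d mod 2ᵏ = ρ` (`ρ < 2ᵏ`) is the class `−d ≡ −ρ (mod 2ᵏ)` of `D = −d`. -/
theorem mod_two_pow_eq_iff_neg_modEq {k ρ : ℕ} (hρ : ρ < 2 ^ k) (d : ℕ) :
    d % 2 ^ k = ρ ↔ -(d:ℤ) ≡ -(ρ:ℤ) [ZMOD ((2 ^ k : ℕ) : ℤ)] := by
  rw [Int.neg_modEq_neg, Int.ModEq, ← Int.natCast_mod, ← Int.natCast_mod, Nat.cast_inj,
    Nat.mod_eq_of_lt hρ]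

/-- The initial sums of the hypothesis, re-indexed by `d = −D`: for `ρ < 2ᵏ`,
`Σ_{D ∈ negFundDiscrs X, D ≡ −ρ (2ᵏ)} (q(D) − 2) = Σ_{d < X, −d fund., d mod 2ᵏ = ρ} (q(−d) − 2)`. -/
theorem sum_progression_eq_sum_range {k ρ : ℕ} (hρ : ρ < 2 ^ k) (X : ℕ) :
    ∑ D ∈ (negFundDiscrs X).filter (fun D => D ≡ -(ρ:ℤ) [ZMOD ((2 ^ k : ℕ) : ℤ)]),
        ((quadFieldThreeTorsion D : ℝ) - 2) =
      ∑ d ∈ (Finset.range X).filter (fun d : ℕ => IsNegFund d ∧ d % 2 ^ k = ρ),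
        ((quadFieldThreeTorsion (-(d:ℤ)) : ℝ) - 2) := by
  rw [sum_negFundDiscrs_filter_eq_sum_range X _ (fun D => (quadFieldThreeTorsion D : ℝ) - 2)]
  refine Finset.sum_congr ?_ fun _ _ => rfl
  refine Finset.filter_congr fun d _ => ?_
  rw [mod_two_pow_eq_iff_neg_modEq hρ]

/-- **`EndJuntaRung` from centred sums in progressions `mod 2ᵏ`.** If for every `k`, every class
`a (mod 2ᵏ)` and every `ε > 0`, eventually in `X`,
`|Σ_{D ∈ negFundDiscrs X, D ≡ a (2ᵏ)} (#Cl₃(D) − 2)| ≤ ε X` (Davenport–Heilbronn's mean `2` in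
every class `mod 2ᵏ`, in the centred form), then `EndJuntaRung` holds: the pinned statistic is
`#Cl₃` on the block; a non-empty cylinder on `k` low + `k` high bits is a class `mod 2ᵏ` on an
interval `[lo, hi) ⊆ [2ⁿ⁻¹, 2ⁿ]`, whose centred sum is a difference of two initial sums, each
eventually `≤ (ε/32) 2ⁿ`; and `2ⁿ ≤ 16 #𝒟_n` eventually. -/
theorem endJuntaRung_of_progressions
    (hprog : ∀ (k : ℕ) (a : ℤ) (ε : ℝ), 0 < ε → ∀ᶠ X : ℕ in atTop,
      |∑ D ∈ (negFundDiscrs X).filter (fun D => D ≡ a [ZMOD ((2 ^ k : ℕ) : ℤ)]),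
          ((quadFieldThreeTorsion D : ℝ) - 2)| ≤ ε * X) :
    EndJuntaRung := by
  intro t ht k ε hε
  -- the initial sums, for every residue `ρ < 2ᵏ`, eventually and uniformly
  set ε' : ℝ := ε / 32 with hε'
  have hε'pos : 0 < ε' := by positivity
  have hS : ∀ ρ : Fin (2 ^ k), ∀ᶠ X : ℕ in atTop,
      |∑ d ∈ (Finset.range X).filter (fun d : ℕ => IsNegFund d ∧ d % 2 ^ k = ρ),
          ((quadFieldThreeTorsion (-(d:ℤ)) : ℝ) - 2)| ≤ ε' * X := by
    intro ρ
    filter_upwards [hprog k (-((ρ : ℕ) : ℤ)) ε' hε'pos] with X hX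
    rwa [sum_progression_eq_sum_range ρ.isLt] at hX
  rw [← Filter.eventually_all] at hS
  obtain ⟨X₀, hX₀⟩ := Filter.eventually_atTop.mp hS
  filter_upwards [eventually_two_pow_le_card_block, eventually_ge_atTop (max (X₀ + 1) (k + 1))]
    with n hdens hn a
  have hn1 : 1 ≤ n := by omega
  have hkn : k ≤ n := by omega
  have hX₀n : X₀ ≤ 2 ^ (n - 1) := by
    have := Nat.lt_two_pow_self (n := n - 1)
    omega
  -- replace `t` by the canonical statistic
  have hsum : ∀ S : Finset ℕ, S ⊆ block n →
      ∑ d ∈ S, ((t (-(d:ℤ)) : ℝ) - 2) = ∑ d ∈ S, ((quadFieldThreeTorsion (-(d:ℤ)) : ℝ) - 2) := by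
    intro S hS
    refine Finset.sum_congr rfl fun d hd => ?_
    rw [Pins.apply_eq ht (mem_block.mp (hS hd)).2]
  show |∑ d ∈ (block n).filter
      (fun d : ℕ => ∀ i < n, (i < k ∨ n ≤ i + k) → Nat.testBit d i = a i), ((t (-(d:ℤ)) : ℝ) - 2)|
    ≤ ε * ((block n).card : ℝ)
  rw [hsum _ (Finset.filter_subset _ _)]
  -- empty cylinder
  by_cases hne : ((block n).filter
      (fun d : ℕ => ∀ i < n, (i < k ∨ n ≤ i + k) → Nat.testBit d i = a i)).Nonempty
  swap
  · rw [Finset.not_nonempty_iff_eq_empty.mp hne, Finset.sum_empty, abs_zero]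
    positivity
  -- non-empty cylinder: a class `mod 2ᵏ` on an interval
  obtain ⟨d₀, hd₀⟩ := hne
  rw [cylinder_eq_of_mem hkn hd₀]
  obtain ⟨lo, hi, hlo, hlohi, hhi, hC⟩ :=
    exists_Ico_eq_filter_mod_div n k (d₀ % 2 ^ k) (d₀ / 2 ^ (n - k))
  rw [hC, sum_Ico_filter_eq_sub hlohi]
  have hρ : d₀ % 2 ^ k < 2 ^ k := Nat.mod_lt _ (by positivity)
  have h1 := hX₀ hi (by omega) ⟨d₀ % 2 ^ k, hρ⟩
  have h2 := hX₀ lo (by omega) ⟨d₀ % 2 ^ k, hρ⟩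
  have hhi' : (hi : ℝ) ≤ 2 ^ n := by exact_mod_cast hhi
  have hlo' : (lo : ℝ) ≤ 2 ^ n := by exact_mod_cast hlohi.trans hhi
  calc |(∑ d ∈ (Finset.range hi).filter (fun d : ℕ => IsNegFund d ∧ d % 2 ^ k = d₀ % 2 ^ k),
            ((quadFieldThreeTorsion (-(d:ℤ)) : ℝ) - 2)) -
          ∑ d ∈ (Finset.range lo).filter (fun d : ℕ => IsNegFund d ∧ d % 2 ^ k = d₀ % 2 ^ k),
            ((quadFieldThreeTorsion (-(d:ℤ)) : ℝ) - 2)|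
        ≤ ε' * hi + ε' * lo := (abs_sub _ _).trans (add_le_add h1 h2)
    _ ≤ ε' * 2 ^ n + ε' * 2 ^ n := by gcongr
    _ = (ε / 16) * 2 ^ n := by rw [hε']; ring
    _ ≤ (ε / 16) * (16 * ((block n).card : ℝ)) := by gcongr
    _ = ε * ((block n).card : ℝ) := by ring

end Summit.QuantumAdvantage.QuantumAdvantage.Theorems.ArithStatLadder

end
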